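import Summits.Ventures.Crystal3D.Theorems.StickyWulffConstantCoaxialWallLawAutomatonEnds
import Summits.Ventures.Crystal3D.Theorems.StickyWulffConstantCoaxialWallLawAutomatonTrans
import HarnessLib

/-!
# The line automaton of the co-axial cell: sources ≤ 26·payers + foreign + band + rim (the abstract count)

HONEST FRAMING. Part of the venture `Summits/Ventures/Crystal3D` (cell `crystal3d-full`), helper for the
crux `CoaxialWallLaw` (stmt-Ventures-19481) of `route-Ventures-StickyWulffConstant`, REGISTERED line
`WallLedgerF` (planner cf-p1 gen 16), open stub `stub_coaxialTwoSlabAdhesion` (general fillings).  Brick 10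
of the FLUX-GAP architecture (memo F-FLUXGAP-ARCH §2): the three counts of the automaton chained —
`card_tops_le_card_ends` (ends = starts), `card_free_ends_le` (free ends pay or are foreign),
`card_trans_le` (transmitted ends sit in the shallow band or on the rim).  Still abstract in the frames;
the concrete twin-pair instantiation and the stub algebra are the next file.  Rung credit only; F-C1 not
moved.

**Theorem (`card_sources_le_automaton`).**  With the data of `…Automaton` / `…AutomatonCount` /
`…AutomatonTrans` and a source slot `u₀` such that `dsg false p = F false u₀` on the inner bottom sample
`P′`:
`#{p ∈ P′ : full shell, zlo < (p + F false u₀)₂ < zcut} ≤ 26 · #{z ∈ X : deg z ≤ 11, zlo − 1 ≤ z₂ ≤ zcut + 1}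
 + #{foreign twin-dozen states} + #{s ∈ P₂ : zcut ≤ s₂ < zcut + sh₂} + 2 · #{rim balls at heights [zcut, zcut+1]}`.

WHAT THIS IS NOT: not the stub; F-C1 not moved.
-/

noncomputable section

namespace Summit.Ventures.Crystal3D.Theorems

open Summit.Ventures.Crystal3D Finset
open Literature.MathematicalPhysics.StatisticalMechanics (fccStacking)
open scoped InnerProductSpace

section Core

open scoped Classical

variable {X P' P₂ : Finset (EuclideanSpace ℝ (Fin 3))} {V : Finset (EuclideanSpace ℝ (Fin 3) × Bool)}
  {F : Bool → (EuclideanSpace ℝ (Fin 3) ≃ₗᵢ[ℝ] EuclideanSpace ℝ (Fin 3))} {m t₂ sh u₀ : EuclideanSpace ℝ (Fin 3)}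
  {dsg : Bool → EuclideanSpace ℝ (Fin 3) → EuclideanSpace ℝ (Fin 3)}
  {f : EuclideanSpace ℝ (Fin 3) × Bool → EuclideanSpace ℝ (Fin 3) × Bool}
  {Full TD Inv : Bool → EuclideanSpace ℝ (Fin 3) → Prop} {zlo zcut h R₀ ρ : ℝ} {cΛ : Bool}

/-- **Sources ≤ 26·payers + foreign + band + rim.**  See the module docstring. -/
theorem card_sources_le_automaton {δ : ℝ} (hg : KissingGap δ) (hc : KissingClassification δ)
    (hX : ∀ p ∈ X, ∀ q ∈ X, p ≠ q → 1 ≤ dist p q) (hm : ‖m‖ = 1)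
    (hmenu : ∀ c, ∀ w ∈ fccSlots,
      ⟪F c w, m⟫_ℝ = 0 ∨ ⟪F c w, m⟫_ℝ = Real.sqrt (2 / 3) ∨ ⟪F c w, m⟫_ℝ = -Real.sqrt (2 / 3))
    (hmir : ∀ c, ∀ w ∈ fccSlots, ∃ w' ∈ fccSlots, F (!c) w' = F c w - (2 * ⟪F c w, m⟫_ℝ) • m)
    (hFull : ∀ c b, Full c b ↔ ∀ w ∈ fccSlots, b + F c w ∈ X)
    (hTD : ∀ c b, TD c b ↔
      ((∀ w ∈ fccSlots, ⟪F c w, m⟫_ℝ ≤ 0 → b + F c w ∈ X) ∧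
       (∀ w ∈ fccSlots, ⟪F c w, m⟫_ℝ < 0 → b + (F c w - (2 * ⟪F c w, m⟫_ℝ) • m) ∈ X) ∧
       (∀ w ∈ fccSlots, 0 < ⟪F c w, m⟫_ℝ → b + F c w ∉ X)))
    (hInv : ∀ c b, Inv c b ↔ ∃ a ∈ fccSlots, ∃ a' ∈ fccSlots, ∃ a'' ∈ fccSlots,
      LinearIndependent ℝ ![a, a', a''] ∧ b + F c a ∈ X ∧ b + F c a' ∈ X ∧ b + F c a'' ∈ X)
    (hdsg_up : ∀ c b, ∃ u ∈ fccSlots, ⟪F c u, m⟫_ℝ = Real.sqrt (2 / 3) ∧ dsg c b = F c u)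
    (hdsg_inv : ∀ c b, ∀ w ∈ fccStacking 1 (Real.sqrt (2 / 3)), dsg c (b + F c w) = dsg c b)
    (hrise : ∀ c b, 0 < dsg c b 2)
    (hf : ∀ v, f v = if Full v.2 v.1 then (v.1 + dsg v.2 v.1, v.2) else (v.1 + dsg (!v.2) v.1, !v.2))
    (hV : ∀ v, v ∈ V ↔ (v.1 ∈ X ∧ zlo ≤ v.1 2 ∧ v.1 2 < zcut ∧ v.1 ∉ P' ∧ Inv v.2 v.1 ∧
      ∃ w ∈ fccSlots, ⟪F v.2 w, m⟫_ℝ < 0 ∧ v.1 + F v.2 w ∈ X))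
    (hP'X : P' ⊆ X) (hP' : ∀ p ∈ P', p 2 ≤ zlo) (hsrc : ∀ p ∈ P', dsg false p = F false u₀)
    (hR₀ : 3 ≤ R₀) (hρ : R₀ ≤ ρ) (hzcut : zcut = h + R₀ + 1)
    (hcell : ∀ p ∈ X, p 2 ≤ h + 2 * R₀ ∧ p 0 ^ 2 + p 1 ^ 2 ≤ ρ ^ 2) (hP₂X : P₂ ⊆ X)
    (hP₂ : ∀ p, p ∈ P₂ ↔ (p ∈ (fun q => F cΛ q + t₂) '' fccStacking 1 (Real.sqrt (2 / 3)) ∧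
      h + R₀ ≤ p 2 ∧ p 2 ≤ h + 2 * R₀ ∧ p 0 ^ 2 + p 1 ^ 2 ≤ ρ ^ 2))
    (hsh : ∀ b ∈ (fun q => F cΛ q + t₂) '' fccStacking 1 (Real.sqrt (2 / 3)), dsg cΛ b = sh)
    (hnon : ∀ b, ∀ w ∈ fccSlots, dsg (!cΛ) b ≠ F cΛ w) :
    (P'.filter fun p => (∀ w ∈ fccSlots, p + F false w ∈ X) ∧
        zlo < (p + F false u₀) 2 ∧ (p + F false u₀) 2 < zcut).card ≤
      26 * (X.filter fun z => (X.filter fun q => dist z q = 1).card ≤ 11 ∧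
          zlo - 1 ≤ z 2 ∧ z 2 ≤ zcut + 1).card +
      (V.filter fun v => ∃ n : EuclideanSpace ℝ (Fin 3), ‖n‖ = 1 ∧ n ≠ m ∧ n ≠ -m ∧
        (∀ w ∈ fccSlots, ⟪F v.2 w, n⟫_ℝ = 0 ∨ ⟪F v.2 w, n⟫_ℝ = Real.sqrt (2 / 3) ∨
          ⟪F v.2 w, n⟫_ℝ = -Real.sqrt (2 / 3)) ∧
        (∀ w ∈ fccSlots, ⟪F v.2 w, n⟫_ℝ ≤ 0 → v.1 + F v.2 w ∈ X) ∧
        (∀ w ∈ fccSlots, ⟪F v.2 w, n⟫_ℝ < 0 → v.1 + (F v.2 w - (2 * ⟪F v.2 w, n⟫_ℝ) • n) ∈ X) ∧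
        (∀ w ∈ fccSlots, 0 < ⟪F v.2 w, n⟫_ℝ → v.1 + F v.2 w ∉ X)).card +
      (P₂.filter fun s => zcut ≤ s 2 ∧ s 2 < zcut + sh 2).card +
      2 * (X.filter fun s => zcut ≤ s 2 ∧ s 2 ≤ zcut + 1 ∧ (ρ - 2) ^ 2 < s 0 ^ 2 + s 1 ^ 2).card := by
  -- the sources are tops in the sense of `card_tops_le_card_ends`
  have hsub : (P'.filter fun p => (∀ w ∈ fccSlots, p + F false w ∈ X) ∧
      zlo < (p + F false u₀) 2 ∧ (p + F false u₀) 2 < zcut) ⊆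
      (P'.filter fun p => Full false p ∧ zlo < (p + dsg false p) 2 ∧ (p + dsg false p) 2 < zcut) := by
    intro p hp
    rw [mem_filter] at hp ⊢
    obtain ⟨hpP, hfull, hlo, hhi⟩ := hp
    rw [hsrc p hpP, hFull]
    exact ⟨hpP, hfull, hlo, hhi⟩
  have h1 := card_tops_le_card_ends hX hm hmenu hmir hFull hTD hInv hdsg_up hdsg_inv hrise hf hV hP'X hP'
  have h2 := card_free_ends_le (P' := P') (zlo := zlo) (zcut := zcut) hg hc hX hFull hTD hInv hV
  have h3 := card_trans_le hX hm hmenu hmir hFull hTD hInv hdsg_up hdsg_inv hrise hf hV hP' hR₀ hρ hzcut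
    hcell hP₂X hP₂ hsh hnon
  have h0 := card_le_card hsub
  omega

end Core

end Summit.Ventures.Crystal3D.Theorems

end
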